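import Literature.MathematicalPhysics.QuantumFieldTheory.Balaban1983to89.B11Eq34BCH

/-!
# `Balaban1983to89.B11Eq31V4Bound` — T. Bałaban, *The variational problem and background fields in renormalization group method for lattice gauge theories*, Commun. Math. Phys. **102** (1985) 277–309 [Balaban1985Variational]: (29)–(31) p. 282 (with (35) p. 283) — the fourth-order remainder `V₄(A, ∂p)` of the plaquette expansion and the bound «|V₄(A, ∂p)| ≦ (1/4!)(|A|(∂p))⁴e^{η|A|(∂p)}» (31) PROVED for the FOUR-factor product `∂₀U₁((p)_z) = Π_{b⊂(∂p)_z} exp iηA′(b)` in a complete normed algebra (triple Cauchy product of the exponential series; binomial majorisation; exponential tail); v2 (same seat): **(35) ⇒ (36)** PROVED — the total-degree-3 component of `∂₀U₁((p)_z)` paired with `U₀(∂p)` under `−Re tr` IS `η⁴ ×` the verbatim (36) `B11Eq34BCH.V3` (Hermitian `A′`, a cyclic star-compatible trace, `Re`/`Im U₀(∂p)` the matrix real/imaginary parts)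

statement-level skeleton of published theorems with citation tags; proofs where landed; nothing here is a claim about the Yang–Mills mass gap

PDF held: `paper:balaban1985-cmp102-variational-background` (journal page = PDF page + 276).  Renders
`run/shared/lean/pub/pub-balaban/b2b-balaban-ref1/pages/1985-cmp102-variational-background/…-p006-x2.png` (p. 282) and
`…-p007-x2.png` (p. 283) READ AS IMAGES by this seat (lit-balaban reader/typer r08, gen 3, 2026-08-21).

CITATION HEADER (lean-in-tree rule 2026-08-18).  WHAT IS REPRODUCED: SKELETON row `B11.Eq29` = displays (29)–(31)
(and the arithmetic (33), which is `B11Smallness.ineq33`); v2 adds the «(35) ⇒ (36)» passage of row `B11.Eq34` (whose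
(34) through degree 3 and (36)-as-a-definition are `B11Eq34BCH`).  Before this module the row had only the ONE-exponential
shape `B11Eq22Remainder.norm_taylorTerm_le` («(31)-shape consequence for ONE exponential … the four-fold plaquette
product, which is not defined here»).  Sibling modules: `B11Eq22Remainder` ((22)–(23)), `B11Eq34BCH` ((34) through
degree 3: `Z1`, `prod2`, `prod3` — imported; the low-degree components below are identified with them),
`B11Eq37NormBound` ((37), (39)–(40)), `B11Smallness` ((33)).

THE PRINT (p. 282 [PDF 6], verbatim from the render).  «We need a bound for V₀(A). To get such a bound we have to
decompose further
  V₀(A) = V^{(3)}(A) + V₄(A), (29)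
or
  V₀(A) = Σ_{p⊂Ω₀} η^d V₀(A, ∂p), V₀(A, ∂p) = V^{(3)}(A, ∂p) + V₄(A, ∂p), (30)
where V^{(3)}(A) is a third order polynomial and the expansion of V₄(A) begins with a fourth order polynomial. We
consider these functions for A belonging to the complexified Lie algebra. A bound for V₄ can be easily obtained. We
have
  |V₄(A, ∂p)| ≦ (1/4!)(|A|(∂p))⁴ e^{η|A|(∂p)}. (31)»
p. 283 [PDF 7]: «∂₀U₁((p)_z) = exp iηR(U₀(x, w))A(z, w) exp iηA(w, x) exp iηA(x, y) · exp iηR(U₀(x, y))A(y, z)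
  = Π_{b⊂(∂p)_z} exp iηA′(b) = … (34)  If we write expansion (26) in the form
  1 − Re tr ∂₀U₁((p)_z)U₀(∂p) = 1 − Re tr U₀(∂p) + η⁴ Σ_{i=1}^{3} V^{(i)}(A, ∂p) + η⁴V₄(A, ∂p), (35)
then (34) yields [(36)]».  (26) p. 282: «A(U₁U₀) = Σ_{p⊂Ω₀} η^{d−4}[1 − Re tr(U₁U₀)(∂p)] = …».

DICTIONARY (abstract; nothing re-declared).  `𝔸` = a complete normed algebra with `‖1‖ = 1` (the `N × N` matrices
with a submultiplicative norm); `Yᵢ = iηA′(bᵢ)`, `b₁ ≺ b₂ ≺ b₃ ≺ b₄` the bonds of `(∂p)_z`, so `∂₀U₁((p)_z) = e^{Y₁}e^{Y₂}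
e^{Y₃}e^{Y₄}` ((34)); `eTerm Y k = Yᵏ/k!` (the exponential series), `cauchy f g` = the Cauchy product of two
`ℕ`-graded families, `grade4 Y₁ Y₂ Y₃ Y₄ N` = the component of total degree `N` of `e^{Y₁}e^{Y₂}e^{Y₃}e^{Y₄}` (so
`η⁴V^{(N)}(A, ∂p) = −Re tr(grade4 N · U₀(∂p))` for `N = 1, 2, 3` and `η⁴V₄(A, ∂p) = −Re tr(Σ_{N≥4} grade4 N · U₀(∂p))`
is the reading of (35)); `|A|(∂p) = Σ_b |A(b)| = Σᵢ|A′(bᵢ)|` (the rotations `R(U₀)` are isometries) — entered as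
majorants `aᵢ ≧ |A′(bᵢ)|`; `τ` = print's `tr` with the silent estimate `|tr(Z U₀(∂p))| ≦ |Z|` (`U₀` unitary) as the
hypothesis `hτ`.

WHAT IS CERTIFIED (kernel, sorry-free; axioms `propext` / `Classical.choice` / `Quot.sound`).
§1 scalar: `sum_antidiagonal_pow_div_factorial` (`Σ_{k+l=N} uᵏ/k! · vˡ/l! = (u + v)ᴺ/N!`), `hasSum_exp_tail`,
`exp_tail_le` (`Σ_{N≥4} sᴺ/N! ≦ (s⁴/4!)eˢ`).  §2 graded families: `norm_cauchy_le` (majorants `uᵏ/k!`, `vˡ/l!`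
give `(u + v)ᴺ/N!`), `summable_norm_cauchy`, `hasSum_cauchy` (Mathlib's Cauchy product), `norm_sub_sum_range_four_le`
(a graded family majorised by `sᴺ/N!` has `‖Σ − Σ_{N<4}‖ ≦ (s⁴/4!)eˢ`).  §3 the four exponentials: `norm_eTerm_le`,
`hasSum_eTerm`, `norm_grade4_le` (`‖grade4 N‖ ≦ (Σuᵢ)ᴺ/N!`), `hasSum_grade4` (`Σ_N grade4 N = e^{Y₁}e^{Y₂}e^{Y₃}e^{Y₄}`),
**`norm_fourExp_sub_taylor_le`** (`‖e^{Y₁}e^{Y₂}e^{Y₃}e^{Y₄} − Σ_{N<4} grade4 N‖ ≦ (s⁴/4!)eˢ`, `s = Σuᵢ`); §3b the low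
degrees `grade4_zero = 1`, `grade4_one = Z1` (= `ΣYᵢ`), `two_smul_grade4_two = prod2`, `twelve_smul_grade4_three =
prod3`, `sum_range_four_grade4` (`Σ_{N<4} grade4 N = 1 + Z1 + ½·prod2 + (1/12)·prod3`, the (34) components of
`B11Eq34BCH`).  §4 **(31)** `ineq31`: with `Yᵢ = iηA′(bᵢ)`,
`|A′(bᵢ)| ≦ aᵢ`, `S = Σaᵢ`, `η > 0` and `|tr(Z U₀(∂p))| ≦ |Z|`:
`|η⁻⁴ tr(R₄ U₀(∂p))| ≦ (1/4!)S⁴e^{ηS}`, `R₄ = ∂₀U₁((p)_z) − Σ_{N<4} grade4 N`; `ineq31_mono` (the same with any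
`S ≧ Σaᵢ`).  §5 (v2) **(35) ⇒ (36)** `eq36_of_eq35`: for Hermitian `A′(bᵢ)`, `Σ_b A′(b) = η(DA)(p)` (25) with
Hermitian `(DA)(p)`, a trace `τ` (cyclic, `τ(X*) = conj τ(X)`), `η ≠ 0`:
`η⁴ · V3 τ (DA)(p) A′ (½(U₀ + U₀*)) (η⁻²(1/2i)(U₀ − U₀*)) η = −Re τ(grade4(iηA′) 3 · U₀(∂p))`, through the homogeneity
of (34)'s terms (`Z1_smul`, `comm2_smul`, `comm3pair_smul`, `comm3triple_smul`), the Hermitian/anti-Hermitian facts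
(`star_comm2`, `star_comm3pair`, `star_comm3triple`, `star_lie_lie(')`) and the trace identities of the (27)-type
(`tau_mul_re`, `tau_mul_im`, `tau_mul_re_of_skew`); `twelve_smul_grade4_three_complex`; and the first-order analogue `eq26_firstOrder` (`−Re tr(grade4 1 · U₀) = η² Im tr((DA)(p)U₀)`, the linear term of (26)).

HONEST SCOPE — what is NOT claimed.  (i) (35) ⇒ (36) is certified for the THIRD-order term (§5) under the stated
reading (Hermitian Lie-algebra elements `A′(b)`; `tr` any cyclic star-compatible linear functional; `Re U₀`, `Im U₀` the
matrix parts `½(U₀ ± U₀*)`/`(1/2i)(…)`); the identifications of `V^{(1)}`, `V^{(2)}` with (26)'s `⟨A, J⟩`, `½⟨A, ΔA⟩`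
(rows `B11.Eq24`/`B11.Eq27`, [5] (3.7)/(3.10)) are not repeated here, and `A(U₁U₀)` itself ((26), a sum over
plaquettes) is not constructed; the remainder bound (31) is for the remainder AFTER ALL terms of total degree `< 4` of
the four-factor product, those terms being identified with (34)'s `Z1`, `½prod2`, `(1/12)prod3`.  (ii) `|Re z| ≦
|z|` is left to the reader of `ineq31` (the bound is stated for `|η⁻⁴ tr(R₄U₀)|`).  (iii) The lattice objects are not
constructed; `hτ` and the norm data are hypotheses in print's letters.  (iv) Nothing here is progress on the summit
`Summit.QuantumFields`.  Unit `lit-balaban-r08` gen 3 (row `B11.Eq29` of `HOME/lit-balaban-r08/ROWS-B11.md`, HOME =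
`run/shared/lean/pub/lit-balaban/`).
-/

namespace Literature.MathematicalPhysics.QuantumFieldTheory.Balaban1983to89.B11Eq31V4Bound

open NormedSpace Finset
open scoped Nat

/-! ## §1 Scalar lemmas: the binomial identity and the exponential tail -/
section Scalar

/-- `Σ_{k+l=N} uᵏ/k! · vˡ/l! = (u + v)ᴺ/N!` (binomial theorem). [cite: Balaban1985Variational, (31) p.282] -/
theorem sum_antidiagonal_pow_div_factorial (u v : ℝ) (N : ℕ) :
    ∑ kl ∈ antidiagonal N, u ^ kl.1 / kl.1 ! * (v ^ kl.2 / kl.2 !) = (u + v) ^ N / N ! := by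
  rw [Finset.Nat.sum_antidiagonal_eq_sum_range_succ_mk, add_pow, Finset.sum_div]
  refine Finset.sum_congr rfl fun k hk => ?_
  have hkN : k ≤ N := Nat.lt_succ_iff.mp (Finset.mem_range.mp hk)
  have h := Nat.choose_mul_factorial_mul_factorial hkN
  have hk0 : (k ! : ℝ) ≠ 0 := by positivity
  have hNk0 : ((N - k) ! : ℝ) ≠ 0 := by positivity
  have hN0 : (N ! : ℝ) ≠ 0 := by positivity
  have h' : ((N.choose k : ℕ) : ℝ) * (k ! : ℝ) * ((N - k) ! : ℝ) = (N ! : ℝ) := by exact_mod_cast h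
  rw [div_mul_div_comm, div_eq_div_iff (mul_ne_zero hk0 hNk0) hN0, ← h']
  ring

/-- The exponential series of a real number, tail after the cubic terms: `Σ_N s^{N+4}/(N+4)!` sums to
`eˢ − (1 + s + s²/2 + s³/6)`. [cite: Balaban1985Variational, (31) p.282] -/
theorem hasSum_exp_tail (s : ℝ) :
    HasSum (fun N : ℕ => s ^ (N + 4) / (N + 4)!) (Real.exp s - ∑ N ∈ range 4, s ^ N / N !) := by
  have hexp : HasSum (fun n : ℕ => s ^ n / n !) (Real.exp s) := by
    rw [Real.exp_eq_exp_ℝ]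
    exact expSeries_div_hasSum_exp s
  exact (hasSum_nat_add_iff' 4).mpr hexp

/-- `Σ_{N≥4} sᴺ/N! ≦ (s⁴/4!)eˢ` for `s ≧ 0` (termwise: `4!·N! ≦ (N + 4)!`). [cite: Balaban1985Variational, (31) p.282] -/
theorem exp_tail_le {s : ℝ} (hs : 0 ≤ s) :
    ∑' N : ℕ, s ^ (N + 4) / (N + 4)! ≤ s ^ 4 / 4 ! * Real.exp s := by
  have hexp : HasSum (fun n : ℕ => s ^ n / n !) (Real.exp s) := by
    rw [Real.exp_eq_exp_ℝ]
    exact expSeries_div_hasSum_exp s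
  have htail := hasSum_exp_tail s
  rw [htail.tsum_eq]
  have hmaj : HasSum (fun n : ℕ => s ^ 4 / 4 ! * (s ^ n / n !)) (s ^ 4 / 4 ! * Real.exp s) := hexp.mul_left _
  refine hasSum_le (fun N => ?_) htail hmaj
  have hfac : (4 ! * N ! : ℕ) ≤ (N + 4)! := by
    have := Nat.factorial_mul_factorial_dvd_factorial_add 4 N
    rw [add_comm] at this
    exact Nat.le_of_dvd (Nat.factorial_pos _) this
  have hfac' : ((4 ! : ℕ) : ℝ) * (N ! : ℝ) ≤ ((N + 4)! : ℝ) := by exact_mod_cast hfac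
  rw [div_mul_div_comm, ← pow_add, add_comm 4 N]
  exact div_le_div_of_nonneg_left (by positivity) (by positivity) hfac'

end Scalar

/-! ## §2 Graded families, their Cauchy product, and the tail after degree 3 -/
section Graded

variable {𝔸 : Type*} [NormedRing 𝔸]

/-- The Cauchy product of two `ℕ`-graded families: `(f ⋆ g)(N) = Σ_{k+l=N} f(k)g(l)` — the degree-`N` component of
`(Σf)(Σg)`. [cite: Balaban1985Variational, (34)-(35) p.283] -/
def cauchy (f g : ℕ → 𝔸) (N : ℕ) : 𝔸 := ∑ kl ∈ antidiagonal N, f kl.1 * g kl.2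

/-- `cauchy` unfolded. [cite: Balaban1985Variational, (34)-(35) p.283] -/
theorem cauchy_apply (f g : ℕ → 𝔸) (N : ℕ) : cauchy f g N = ∑ kl ∈ antidiagonal N, f kl.1 * g kl.2 := rfl

/-- Majorisation of the Cauchy product: `‖f k‖ ≦ uᵏ/k!`, `‖g l‖ ≦ vˡ/l!` give `‖(f ⋆ g)(N)‖ ≦ (u + v)ᴺ/N!`.
[cite: Balaban1985Variational, (31) p.282] -/
theorem norm_cauchy_le {f g : ℕ → 𝔸} {u v : ℝ} (hf : ∀ k, ‖f k‖ ≤ u ^ k / k !)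
    (hg : ∀ l, ‖g l‖ ≤ v ^ l / l !) (N : ℕ) : ‖cauchy f g N‖ ≤ (u + v) ^ N / N ! := by
  rw [cauchy_apply]
  calc ‖∑ kl ∈ antidiagonal N, f kl.1 * g kl.2‖ ≤ ∑ kl ∈ antidiagonal N, ‖f kl.1 * g kl.2‖ := norm_sum_le _ _
    _ ≤ ∑ kl ∈ antidiagonal N, u ^ kl.1 / kl.1 ! * (v ^ kl.2 / kl.2 !) := by
        refine Finset.sum_le_sum fun kl _ => (norm_mul_le _ _).trans ?_
        exact mul_le_mul (hf _) (hg _) (norm_nonneg _) ((norm_nonneg _).trans (hf _))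
    _ = (u + v) ^ N / N ! := sum_antidiagonal_pow_div_factorial u v N

/-- Norm-summability of the Cauchy product of two norm-summable families (Mathlib).
[cite: Balaban1985Variational, (34)-(35) p.283] -/
theorem summable_norm_cauchy {f g : ℕ → 𝔸} (hf : Summable fun k => ‖f k‖) (hg : Summable fun l => ‖g l‖) :
    Summable fun N => ‖cauchy f g N‖ :=
  summable_norm_sum_mul_antidiagonal_of_summable_norm hf hg

/-- The Cauchy product sums to the product of the sums (Mathlib's Cauchy-product theorem, complete normed ring).
[cite: Balaban1985Variational, (34)-(35) p.283] -/
theorem hasSum_cauchy [CompleteSpace 𝔸] {f g : ℕ → 𝔸} (hf : Summable fun k => ‖f k‖)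
    (hg : Summable fun l => ‖g l‖) : HasSum (cauchy f g) ((∑' k, f k) * ∑' l, g l) := by
  have h := tsum_mul_tsum_eq_tsum_sum_antidiagonal_of_summable_norm hf hg
  have hs : Summable (cauchy f g) := (summable_norm_cauchy hf hg).of_norm
  rw [h]
  exact hs.hasSum

/-- **The tail after degree 3**: a graded family `c` with `Σ_N c(N) = P`, norm-summable and majorised by `sᴺ/N!`, has
`‖P − Σ_{N<4} c(N)‖ ≦ Σ_{N≥4} sᴺ/N! ≦ (s⁴/4!)eˢ`. [cite: Balaban1985Variational, (31) p.282] -/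
theorem norm_sub_sum_range_four_le {c : ℕ → 𝔸} {P : 𝔸} {s : ℝ} (hs : 0 ≤ s) (hsum : HasSum c P)
    (hnorm : Summable fun N => ‖c N‖) (hle : ∀ N, ‖c N‖ ≤ s ^ N / N !) :
    ‖P - ∑ N ∈ range 4, c N‖ ≤ s ^ 4 / 4 ! * Real.exp s := by
  have htail : HasSum (fun N => c (N + 4)) (P - ∑ N ∈ range 4, c N) := (hasSum_nat_add_iff' 4).mpr hsum
  rw [← htail.tsum_eq]
  have hnorm' : Summable fun N => ‖c (N + 4)‖ := (summable_nat_add_iff 4).mpr hnorm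
  have hreal : Summable fun N : ℕ => s ^ (N + 4) / (N + 4)! := (hasSum_exp_tail s).summable
  calc ‖∑' N, c (N + 4)‖ ≤ ∑' N, ‖c (N + 4)‖ := norm_tsum_le_tsum_norm hnorm'
    _ ≤ ∑' N : ℕ, s ^ (N + 4) / (N + 4)! := Summable.tsum_le_tsum (fun N => hle (N + 4)) hnorm' hreal
    _ ≤ s ^ 4 / 4 ! * Real.exp s := exp_tail_le hs

end Graded

/-! ## §3 The four exponentials `e^{Y₁}e^{Y₂}e^{Y₃}e^{Y₄} = Π_{b⊂(∂p)_z} exp iηA′(b)` -/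
section FourExp

variable {𝔸 : Type*} [NormedRing 𝔸] [NormedAlgebra ℝ 𝔸]

/-- The exponential series term `Yᵏ/k!`. [cite: Balaban1985Variational, (22) p.281, (34) p.283] -/
noncomputable def eTerm (Y : 𝔸) (k : ℕ) : 𝔸 := ((k ! : ℝ)⁻¹) • Y ^ k

/-- `eTerm` unfolded. [cite: Balaban1985Variational, (22) p.281] -/
theorem eTerm_apply (Y : 𝔸) (k : ℕ) : eTerm Y k = ((k ! : ℝ)⁻¹) • Y ^ k := rfl

/-- The exponential series is norm-summable (Mathlib). [cite: Balaban1985Variational, (22) p.281] -/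
theorem summable_norm_eTerm (Y : 𝔸) : Summable fun k => ‖eTerm Y k‖ :=
  norm_expSeries_summable' (𝕂 := ℝ) Y

/-- `Σ_k Yᵏ/k! = e^Y` (Mathlib). [cite: Balaban1985Variational, (22) p.281] -/
theorem hasSum_eTerm [CompleteSpace 𝔸] (Y : 𝔸) : HasSum (eTerm Y) (exp Y) :=
  exp_series_hasSum_exp' (𝕂 := ℝ) Y

/-- `‖Yᵏ/k!‖ ≦ uᵏ/k!` for `‖Y‖ ≦ u` (`‖1‖ = 1`). [cite: Balaban1985Variational, (31) p.282] -/
theorem norm_eTerm_le [NormOneClass 𝔸] {Y : 𝔸} {u : ℝ} (hY : ‖Y‖ ≤ u) (k : ℕ) : ‖eTerm Y k‖ ≤ u ^ k / k ! := by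
  rw [eTerm_apply, norm_smul, norm_inv, Real.norm_natCast, div_eq_inv_mul]
  refine mul_le_mul_of_nonneg_left ?_ (by positivity)
  exact (norm_pow_le Y k).trans (pow_le_pow_left₀ (norm_nonneg _) hY k)

/-- The component of total degree `N` of `e^{Y₁}e^{Y₂}e^{Y₃}e^{Y₄}`: the triple Cauchy product of the four exponential
series — the grading of (35) («η⁴Σ_{i=1}^{3}V^{(i)} + η⁴V₄»). [cite: Balaban1985Variational, (34)-(35) p.283] -/
noncomputable def grade4 (Y₁ Y₂ Y₃ Y₄ : 𝔸) : ℕ → 𝔸 :=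
  cauchy (cauchy (cauchy (eTerm Y₁) (eTerm Y₂)) (eTerm Y₃)) (eTerm Y₄)

/-- `grade4` unfolded. [cite: Balaban1985Variational, (34)-(35) p.283] -/
theorem grade4_def (Y₁ Y₂ Y₃ Y₄ : 𝔸) :
    grade4 Y₁ Y₂ Y₃ Y₄ = cauchy (cauchy (cauchy (eTerm Y₁) (eTerm Y₂)) (eTerm Y₃)) (eTerm Y₄) := rfl

/-- Norm-summability of the components. [cite: Balaban1985Variational, (34)-(35) p.283] -/
theorem summable_norm_grade4 (Y₁ Y₂ Y₃ Y₄ : 𝔸) : Summable fun N => ‖grade4 Y₁ Y₂ Y₃ Y₄ N‖ :=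
  summable_norm_cauchy (summable_norm_cauchy (summable_norm_cauchy (summable_norm_eTerm Y₁)
    (summable_norm_eTerm Y₂)) (summable_norm_eTerm Y₃)) (summable_norm_eTerm Y₄)

/-- **Majorisation of the components**: `‖grade4 N‖ ≦ (u₁ + u₂ + u₃ + u₄)ᴺ/N!` for `‖Yᵢ‖ ≦ uᵢ` — the multinomial
count behind (31). [cite: Balaban1985Variational, (31) p.282] -/
theorem norm_grade4_le [NormOneClass 𝔸] {Y₁ Y₂ Y₃ Y₄ : 𝔸} {u₁ u₂ u₃ u₄ : ℝ} (h₁ : ‖Y₁‖ ≤ u₁) (h₂ : ‖Y₂‖ ≤ u₂)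
    (h₃ : ‖Y₃‖ ≤ u₃) (h₄ : ‖Y₄‖ ≤ u₄) (N : ℕ) :
    ‖grade4 Y₁ Y₂ Y₃ Y₄ N‖ ≤ (u₁ + u₂ + u₃ + u₄) ^ N / N ! :=
  norm_cauchy_le (norm_cauchy_le (norm_cauchy_le (norm_eTerm_le h₁) (norm_eTerm_le h₂)) (norm_eTerm_le h₃))
    (norm_eTerm_le h₄) N

/-- **The grading sums to the product**: `Σ_N grade4 N = e^{Y₁}e^{Y₂}e^{Y₃}e^{Y₄} = ∂₀U₁((p)_z)` ((34)).
[cite: Balaban1985Variational, (34)-(35) p.283] -/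
theorem hasSum_grade4 [CompleteSpace 𝔸] (Y₁ Y₂ Y₃ Y₄ : 𝔸) :
    HasSum (grade4 Y₁ Y₂ Y₃ Y₄) (exp Y₁ * exp Y₂ * exp Y₃ * exp Y₄) := by
  have n12 := summable_norm_cauchy (summable_norm_eTerm Y₁) (summable_norm_eTerm Y₂)
  have h12 := hasSum_cauchy (summable_norm_eTerm Y₁) (summable_norm_eTerm Y₂)
  rw [(hasSum_eTerm Y₁).tsum_eq, (hasSum_eTerm Y₂).tsum_eq] at h12
  have n123 := summable_norm_cauchy n12 (summable_norm_eTerm Y₃)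
  have h123 := hasSum_cauchy n12 (summable_norm_eTerm Y₃)
  rw [h12.tsum_eq, (hasSum_eTerm Y₃).tsum_eq] at h123
  have h1234 := hasSum_cauchy n123 (summable_norm_eTerm Y₄)
  rw [h123.tsum_eq, (hasSum_eTerm Y₄).tsum_eq] at h1234
  exact h1234

/-- **The four-factor fourth-order remainder bound** (the content of (31)): with `s = u₁ + u₂ + u₃ + u₄`, `‖Yᵢ‖ ≦ uᵢ`,
`‖e^{Y₁}e^{Y₂}e^{Y₃}e^{Y₄} − Σ_{N<4} grade4 N‖ ≦ (s⁴/4!)eˢ`. [cite: Balaban1985Variational, (31) p.282] -/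
theorem norm_fourExp_sub_taylor_le [NormOneClass 𝔸] [CompleteSpace 𝔸] {Y₁ Y₂ Y₃ Y₄ : 𝔸} {u₁ u₂ u₃ u₄ : ℝ}
    (h₁ : ‖Y₁‖ ≤ u₁) (h₂ : ‖Y₂‖ ≤ u₂) (h₃ : ‖Y₃‖ ≤ u₃) (h₄ : ‖Y₄‖ ≤ u₄) :
    ‖exp Y₁ * exp Y₂ * exp Y₃ * exp Y₄ - ∑ N ∈ range 4, grade4 Y₁ Y₂ Y₃ Y₄ N‖ ≤
      (u₁ + u₂ + u₃ + u₄) ^ 4 / 4 ! * Real.exp (u₁ + u₂ + u₃ + u₄) := by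
  have hu₁ : 0 ≤ u₁ := (norm_nonneg _).trans h₁
  have hu₂ : 0 ≤ u₂ := (norm_nonneg _).trans h₂
  have hu₃ : 0 ≤ u₃ := (norm_nonneg _).trans h₃
  have hu₄ : 0 ≤ u₄ := (norm_nonneg _).trans h₄
  exact norm_sub_sum_range_four_le (by positivity) (hasSum_grade4 Y₁ Y₂ Y₃ Y₄) (summable_norm_grade4 Y₁ Y₂ Y₃ Y₄)
    (norm_grade4_le h₁ h₂ h₃ h₄)

end FourExp

/-! ## §3b The components of degree `< 4` are (34)'s `1`, `Z₁`, `½·prod2`, `(1/12)·prod3` -/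
section LowDegrees

variable {𝔸 : Type*} [NormedRing 𝔸] [NormedAlgebra ℝ 𝔸]

open B11Eq34BCH (Z1 prod2 prod3)

/-- Degree 0: `grade4 0 = 1`. [cite: Balaban1985Variational, (34)-(35) p.283] -/
theorem grade4_zero (Y₁ Y₂ Y₃ Y₄ : 𝔸) : grade4 Y₁ Y₂ Y₃ Y₄ 0 = 1 := by
  simp [grade4_def, cauchy_apply, eTerm_apply]

/-- Degree 1: `grade4 1 = Y₁ + Y₂ + Y₃ + Y₄ = Z₁` (print: `iηΣ_b A′(b)`). [cite: Balaban1985Variational, (34) p.283] -/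
theorem grade4_one (Y₁ Y₂ Y₃ Y₄ : 𝔸) : grade4 Y₁ Y₂ Y₃ Y₄ 1 = Z1 Y₁ Y₂ Y₃ Y₄ := by
  simp [grade4_def, cauchy_apply, eTerm_apply, Finset.Nat.sum_antidiagonal_eq_sum_range_succ_mk,
    Finset.sum_range_succ, Z1]
  abel

/-- A numeral of `𝔸` is the corresponding real multiple of `1`. [cite: Balaban1985Variational, (34) p.283] -/
theorem natCast_eq_smul_one (n : ℕ) : (n : 𝔸) = (n : ℝ) • (1 : 𝔸) := by
  rw [Nat.cast_smul_eq_nsmul, nsmul_eq_mul, mul_one]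

/-- Degree 2: `2·grade4 2 = ΣYᵢ² + 2Σ_{i≺j}YᵢYⱼ = prod2`. [cite: Balaban1985Variational, (34) p.283] -/
theorem two_smul_grade4_two (Y₁ Y₂ Y₃ Y₄ : 𝔸) : (2 : ℝ) • grade4 Y₁ Y₂ Y₃ Y₄ 2 = prod2 Y₁ Y₂ Y₃ Y₄ := by
  simp only [grade4_def, cauchy_apply, eTerm_apply, Finset.Nat.sum_antidiagonal_eq_sum_range_succ_mk,
    Finset.sum_range_succ, Finset.sum_range_zero]
  norm_num [Nat.factorial, smul_mul_assoc, mul_smul_comm, smul_smul, smul_add, sq, mul_add, add_mul, mul_assoc]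
  have e2 : (2 : 𝔸) = (2 : ℝ) • (1 : 𝔸) := by
    rw [show (2 : 𝔸) = ((2 : ℕ) : 𝔸) by norm_num, show (2 : ℝ) = ((2 : ℕ) : ℝ) by norm_num]
    exact natCast_eq_smul_one 2
  simp only [prod2, mul_add, e2, smul_mul_assoc, one_mul]
  module

/-- Degree 3: `12·grade4 3 = 2ΣYᵢ³ + 6Σ_{i≺j}(Yᵢ²Yⱼ + YᵢYⱼ²) + 12Σ_{i≺j≺k}YᵢYⱼYₖ = prod3`.
[cite: Balaban1985Variational, (34) p.283] -/
theorem twelve_smul_grade4_three (Y₁ Y₂ Y₃ Y₄ : 𝔸) :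
    (12 : ℝ) • grade4 Y₁ Y₂ Y₃ Y₄ 3 = prod3 Y₁ Y₂ Y₃ Y₄ := by
  simp only [grade4_def, cauchy_apply, eTerm_apply, Finset.Nat.sum_antidiagonal_eq_sum_range_succ_mk,
    Finset.sum_range_succ, Finset.sum_range_zero]
  norm_num [Nat.factorial, smul_mul_assoc, mul_smul_comm, smul_smul, smul_add, sq, pow_succ, mul_add, add_mul,
    mul_assoc]
  have e2 : (2 : 𝔸) = (2 : ℝ) • (1 : 𝔸) := by
    rw [show (2 : 𝔸) = ((2 : ℕ) : 𝔸) by norm_num, show (2 : ℝ) = ((2 : ℕ) : ℝ) by norm_num]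
    exact natCast_eq_smul_one 2
  have e6 : (6 : 𝔸) = (6 : ℝ) • (1 : 𝔸) := by
    rw [show (6 : 𝔸) = ((6 : ℕ) : 𝔸) by norm_num, show (6 : ℝ) = ((6 : ℕ) : ℝ) by norm_num]
    exact natCast_eq_smul_one 6
  have e12 : (12 : 𝔸) = (12 : ℝ) • (1 : 𝔸) := by
    rw [show (12 : 𝔸) = ((12 : ℕ) : 𝔸) by norm_num, show (12 : ℝ) = ((12 : ℕ) : ℝ) by norm_num]
    exact natCast_eq_smul_one 12
  simp only [prod3, mul_add, e2, e6, e12, smul_mul_assoc, one_mul, mul_assoc]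
  module

/-- The Taylor part of degree `< 4` of `e^{Y₁}e^{Y₂}e^{Y₃}e^{Y₄}` is (34)'s `1 + Z₁ + ½(Z₁² + C) + (1/12)(2Z₁³ +
3(Z₁C + CZ₁) + P + 2T)` = `1 + Z1 + ½·prod2 + (1/12)·prod3`. [cite: Balaban1985Variational, (34)-(35) p.283] -/
theorem sum_range_four_grade4 (Y₁ Y₂ Y₃ Y₄ : 𝔸) :
    ∑ N ∈ range 4, grade4 Y₁ Y₂ Y₃ Y₄ N =
      1 + Z1 Y₁ Y₂ Y₃ Y₄ + (2 : ℝ)⁻¹ • prod2 Y₁ Y₂ Y₃ Y₄ + (12 : ℝ)⁻¹ • prod3 Y₁ Y₂ Y₃ Y₄ := by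
  rw [← two_smul_grade4_two, ← twelve_smul_grade4_three, smul_smul, smul_smul]
  norm_num
  simp only [Finset.sum_range_succ, Finset.sum_range_zero, zero_add, grade4_zero, grade4_one]

end LowDegrees

/-! ## §4 (31) for `V₄(A, ∂p)` -/
section Ineq31

variable {𝔸 : Type*} [NormedRing 𝔸] [NormedAlgebra ℂ 𝔸]

/-- `‖iηA‖ = η‖A‖ ≦ ηa` for `η ≧ 0`, `‖A‖ ≦ a`. [cite: Balaban1985Variational, (31) p.282] -/
theorem norm_I_eta_smul_le {A : 𝔸} {η a : ℝ} (hη : 0 ≤ η) (hA : ‖A‖ ≤ a) :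
    ‖((Complex.I * η : ℂ)) • A‖ ≤ η * a := by
  rw [norm_smul, norm_mul, Complex.norm_I, one_mul, Complex.norm_real, Real.norm_of_nonneg hη]
  exact mul_le_mul_of_nonneg_left hA hη

/-- **(31)** «|V₄(A, ∂p)| ≦ (1/4!)(|A|(∂p))⁴e^{η|A|(∂p)}»: with `Yᵢ = iηA′(bᵢ)`, `R₄ = e^{Y₁}e^{Y₂}e^{Y₃}e^{Y₄} −
Σ_{N<4} grade4 N` (the terms of order `≧ 4` of `∂₀U₁((p)_z)`, (34)/(35)), `η⁴V₄(A, ∂p) = −Re tr(R₄U₀(∂p))`, the trace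
estimate `|tr(Z U₀(∂p))| ≦ |Z|` and `|A′(bᵢ)| ≦ aᵢ`, `|A|(∂p) = a₁ + a₂ + a₃ + a₄`, `η > 0`:
`|η⁻⁴ tr(R₄U₀(∂p))| ≦ (1/4!)(|A|(∂p))⁴e^{η|A|(∂p)}` (and `|Re z| ≦ |z|`). [cite: Balaban1985Variational, (31) p.282] -/
theorem ineq31 [NormOneClass 𝔸] [CompleteSpace 𝔸] (τ : 𝔸 →ₗ[ℂ] ℂ) (U0 : 𝔸)
    (hτ : ∀ Z : 𝔸, ‖τ (Z * U0)‖ ≤ ‖Z‖) {A₁ A₂ A₃ A₄ : 𝔸} {η a₁ a₂ a₃ a₄ : ℝ} (hη : 0 < η)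
    (h₁ : ‖A₁‖ ≤ a₁) (h₂ : ‖A₂‖ ≤ a₂) (h₃ : ‖A₃‖ ≤ a₃) (h₄ : ‖A₄‖ ≤ a₄) :
    ‖((η ^ 4)⁻¹ : ℝ) • τ ((exp ((Complex.I * η : ℂ) • A₁) * exp ((Complex.I * η : ℂ) • A₂)
        * exp ((Complex.I * η : ℂ) • A₃) * exp ((Complex.I * η : ℂ) • A₄)
        - ∑ N ∈ range 4, grade4 ((Complex.I * η : ℂ) • A₁) ((Complex.I * η : ℂ) • A₂)
            ((Complex.I * η : ℂ) • A₃) ((Complex.I * η : ℂ) • A₄) N) * U0)‖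
      ≤ 1 / 4 ! * (a₁ + a₂ + a₃ + a₄) ^ 4 * Real.exp (η * (a₁ + a₂ + a₃ + a₄)) := by
  have hR := norm_fourExp_sub_taylor_le (norm_I_eta_smul_le hη.le h₁) (norm_I_eta_smul_le hη.le h₂)
    (norm_I_eta_smul_le hη.le h₃) (norm_I_eta_smul_le hη.le h₄)
  have hs : η * a₁ + η * a₂ + η * a₃ + η * a₄ = η * (a₁ + a₂ + a₃ + a₄) := by ring
  rw [hs] at hR
  rw [norm_smul, norm_inv, norm_pow, Real.norm_of_nonneg hη.le]
  have hη4 : 0 < η ^ 4 := by positivity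
  rw [inv_mul_le_iff₀ hη4]
  refine ((hτ _).trans hR).trans (le_of_eq ?_)
  rw [mul_pow]
  ring

/-- (31) with any majorant `S ≧ Σᵢaᵢ` of `|A|(∂p)` (monotonicity of `S ↦ S⁴e^{ηS}`).
[cite: Balaban1985Variational, (31) p.282] -/
theorem ineq31_mono [NormOneClass 𝔸] [CompleteSpace 𝔸] (τ : 𝔸 →ₗ[ℂ] ℂ) (U0 : 𝔸)
    (hτ : ∀ Z : 𝔸, ‖τ (Z * U0)‖ ≤ ‖Z‖) {A₁ A₂ A₃ A₄ : 𝔸} {η a₁ a₂ a₃ a₄ S : ℝ} (hη : 0 < η)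
    (h₁ : ‖A₁‖ ≤ a₁) (h₂ : ‖A₂‖ ≤ a₂) (h₃ : ‖A₃‖ ≤ a₃) (h₄ : ‖A₄‖ ≤ a₄) (hS : a₁ + a₂ + a₃ + a₄ ≤ S) :
    ‖((η ^ 4)⁻¹ : ℝ) • τ ((exp ((Complex.I * η : ℂ) • A₁) * exp ((Complex.I * η : ℂ) • A₂)
        * exp ((Complex.I * η : ℂ) • A₃) * exp ((Complex.I * η : ℂ) • A₄)
        - ∑ N ∈ range 4, grade4 ((Complex.I * η : ℂ) • A₁) ((Complex.I * η : ℂ) • A₂)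
            ((Complex.I * η : ℂ) • A₃) ((Complex.I * η : ℂ) • A₄) N) * U0)‖
      ≤ 1 / 4 ! * S ^ 4 * Real.exp (η * S) := by
  have h := ineq31 τ U0 hτ hη h₁ h₂ h₃ h₄
  have hsum0 : 0 ≤ a₁ + a₂ + a₃ + a₄ := by
    have := (norm_nonneg _).trans h₁; have := (norm_nonneg _).trans h₂
    have := (norm_nonneg _).trans h₃; have := (norm_nonneg _).trans h₄
    positivity
  refine h.trans ?_
  have hp : (a₁ + a₂ + a₃ + a₄) ^ 4 ≤ S ^ 4 := pow_le_pow_left₀ hsum0 hS 4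
  have he : Real.exp (η * (a₁ + a₂ + a₃ + a₄)) ≤ Real.exp (η * S) :=
    Real.exp_le_exp.mpr (mul_le_mul_of_nonneg_left hS hη.le)
  have hS4 : 0 ≤ S ^ 4 := by
    have hS0 : 0 ≤ S := hsum0.trans hS
    positivity
  calc 1 / 4 ! * (a₁ + a₂ + a₃ + a₄) ^ 4 * Real.exp (η * (a₁ + a₂ + a₃ + a₄))
        ≤ 1 / 4 ! * S ^ 4 * Real.exp (η * (a₁ + a₂ + a₃ + a₄)) := by
          gcongr
    _ ≤ 1 / 4 ! * S ^ 4 * Real.exp (η * S) := by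
          gcongr

end Ineq31


/-! ## §5 (35) ⇒ (36): the third-order term of `1 − Re tr ∂₀U₁((p)_z)U₀(∂p)` IS the printed `V^{(3)}`

«If we write expansion (26) in the form 1 − Re tr ∂₀U₁((p)_z)U₀(∂p) = 1 − Re tr U₀(∂p) + η⁴Σ_{i=1}^{3}V^{(i)}(A, ∂p) +
η⁴V₄(A, ∂p), (35) then (34) yields [(36)]» (p. 283): with `Yᵢ = iηA′(bᵢ)` selfadjoint `A′(bᵢ)`, `Σ_b A′(b) = η(DA)(p)`
((25)), a trace `tr` (cyclic, `tr(X*) = conj tr(X)`), `Re U₀(∂p) = ½(U₀ + U₀*)`, `Im U₀(∂p) = (1/2i)(U₀ − U₀*)`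
(the matrix real/imaginary parts, as in (27) «From hermiticity of DA we have Σ Im tr(DA)(p)U₀(∂p) = Σ tr(DA)(p)
Im U₀(∂p)», p. 282): `η⁴V^{(3)}(A, ∂p) := −Re tr(grade4 3 · U₀(∂p))` equals `η⁴ ×` the verbatim (36)
`B11Eq34BCH.V3`. -/
section Homogeneity

variable {𝔸 : Type*} [Ring 𝔸] [Algebra ℂ 𝔸]

open B11Eq34BCH (Z1 comm2 comm3pair comm3triple prod3 bch4_degree3 V3 V3_eq)

/-- `[cA, dB] = cd[A, B]`. [cite: Balaban1985Variational, (34) p.283] -/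
theorem lie_smul_smul (c d : ℂ) (A B : 𝔸) : ⁅c • A, d • B⁆ = (c * d) • ⁅A, B⁆ := by
  simp only [Ring.lie_def, smul_mul_smul_comm, smul_sub, mul_comm d c]

/-- `Z₁` is linear: `Z₁(cA) = cZ₁(A)` (so `Z₁(iηA′) = iη·η(DA)(p)` by (25)). [cite: Balaban1985Variational, (34) p.283] -/
theorem Z1_smul (c : ℂ) (A₁ A₂ A₃ A₄ : 𝔸) :
    Z1 (c • A₁) (c • A₂) (c • A₃) (c • A₄) = c • Z1 A₁ A₂ A₃ A₄ := by
  simp only [Z1, smul_add]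

/-- The second-order BCH term is quadratic: `C(cA) = c²C(A)` (`½i²η²Σ[A′, A′]` in (34)).
[cite: Balaban1985Variational, (34) p.283] -/
theorem comm2_smul (c : ℂ) (A₁ A₂ A₃ A₄ : 𝔸) :
    comm2 (c • A₁) (c • A₂) (c • A₃) (c • A₄) = c ^ 2 • comm2 A₁ A₂ A₃ A₄ := by
  simp only [comm2, lie_smul_smul, smul_add, pow_two]

/-- The third-order pair term is cubic: `P(cA) = c³P(A)` (`(1/12)i³η³Σ(…)` in (34)).
[cite: Balaban1985Variational, (34) p.283] -/
theorem comm3pair_smul (c : ℂ) (A₁ A₂ A₃ A₄ : 𝔸) :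
    comm3pair (c • A₁) (c • A₂) (c • A₃) (c • A₄) = c ^ 3 • comm3pair A₁ A₂ A₃ A₄ := by
  simp only [comm3pair, lie_smul_smul, smul_add]
  ring_nf

/-- The third-order triple term is cubic: `T(cA) = c³T(A)` (`(1/6)i³η³Σ(…)` in (34)).
[cite: Balaban1985Variational, (34) p.283] -/
theorem comm3triple_smul (c : ℂ) (A₁ A₂ A₃ A₄ : 𝔸) :
    comm3triple (c • A₁) (c • A₂) (c • A₃) (c • A₄) = c ^ 3 • comm3triple A₁ A₂ A₃ A₄ := by
  simp only [comm3triple, lie_smul_smul, smul_add]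
  ring_nf

end Homogeneity

section StarFacts

variable {𝔸 : Type*} [Ring 𝔸] [StarRing 𝔸]

open B11Eq34BCH (comm2 comm3pair comm3triple)

/-- For selfadjoint (Hermitian) `A, B`: `[A, B]* = −[A, B]` (so `i[A′, A′]` is Hermitian, as written in (36)).
[cite: Balaban1985Variational, (36) pp.283-284] -/
theorem star_lie_of_isSelfAdjoint {A B : 𝔸} (hA : IsSelfAdjoint A) (hB : IsSelfAdjoint B) :
    star ⁅A, B⁆ = -⁅A, B⁆ := by
  rw [Ring.lie_def, star_sub, star_mul, star_mul, hA.star_eq, hB.star_eq]; abel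

/-- `(Σ_{i≺j}[A′ᵢ, A′ⱼ])* = −Σ_{i≺j}[A′ᵢ, A′ⱼ]` for Hermitian `A′`. [cite: Balaban1985Variational, (36) pp.283-284] -/
theorem star_comm2 {A₁ A₂ A₃ A₄ : 𝔸} (h₁ : IsSelfAdjoint A₁) (h₂ : IsSelfAdjoint A₂) (h₃ : IsSelfAdjoint A₃)
    (h₄ : IsSelfAdjoint A₄) : star (comm2 A₁ A₂ A₃ A₄) = -comm2 A₁ A₂ A₃ A₄ := by
  simp only [comm2, star_add, star_lie_of_isSelfAdjoint h₁ h₂, star_lie_of_isSelfAdjoint h₁ h₃,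
    star_lie_of_isSelfAdjoint h₁ h₄, star_lie_of_isSelfAdjoint h₂ h₃, star_lie_of_isSelfAdjoint h₂ h₄,
    star_lie_of_isSelfAdjoint h₃ h₄]
  abel

/-- `[A, [B, C]]` is Hermitian for Hermitian `A, B, C` (so `i[A′, i[A′, A′]] = −[A′, [A′, A′]]` in (36) is Hermitian).
[cite: Balaban1985Variational, (36) pp.283-284] -/
theorem star_lie_lie {A B C : 𝔸} (hA : IsSelfAdjoint A) (hB : IsSelfAdjoint B) (hC : IsSelfAdjoint C) :
    star ⁅A, ⁅B, C⁆⁆ = ⁅A, ⁅B, C⁆⁆ := by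
  simp only [Ring.lie_def, star_sub, star_mul, hA.star_eq, hB.star_eq, hC.star_eq]
  noncomm_ring

/-- `[[A, B], C]` is Hermitian for Hermitian `A, B, C`. [cite: Balaban1985Variational, (36) pp.283-284] -/
theorem star_lie_lie' {A B C : 𝔸} (hA : IsSelfAdjoint A) (hB : IsSelfAdjoint B) (hC : IsSelfAdjoint C) :
    star ⁅⁅A, B⁆, C⁆ = ⁅⁅A, B⁆, C⁆ := by
  simp only [Ring.lie_def, star_sub, star_mul, hA.star_eq, hB.star_eq, hC.star_eq]
  noncomm_ring

/-- The pair double-commutator sum `P` is Hermitian. [cite: Balaban1985Variational, (36) pp.283-284] -/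
theorem star_comm3pair {A₁ A₂ A₃ A₄ : 𝔸} (h₁ : IsSelfAdjoint A₁) (h₂ : IsSelfAdjoint A₂) (h₃ : IsSelfAdjoint A₃)
    (h₄ : IsSelfAdjoint A₄) : star (comm3pair A₁ A₂ A₃ A₄) = comm3pair A₁ A₂ A₃ A₄ := by
  simp only [comm3pair, star_add, star_lie_lie, star_lie_lie', h₁, h₂, h₃, h₄]

/-- The triple double-commutator sum `T` is Hermitian. [cite: Balaban1985Variational, (36) pp.283-284] -/
theorem star_comm3triple {A₁ A₂ A₃ A₄ : 𝔸} (h₁ : IsSelfAdjoint A₁) (h₂ : IsSelfAdjoint A₂)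
    (h₃ : IsSelfAdjoint A₃) (h₄ : IsSelfAdjoint A₄) :
    star (comm3triple A₁ A₂ A₃ A₄) = comm3triple A₁ A₂ A₃ A₄ := by
  simp only [comm3triple, star_add, star_lie_lie, star_lie_lie', h₁, h₂, h₃, h₄]

variable [Algebra ℂ 𝔸] {τ : 𝔸 →ₗ[ℂ] ℂ}

/-- «From hermiticity … tr(X)Im U₀(∂p) = Im tr(X U₀(∂p))»-type identities (cf. (27) p. 282): for a trace `τ` (cyclic,
`τ(X*) = conj τ(X)`) and Hermitian `H`, `τ(H · ½(U + U*)) = Re τ(HU)`. [cite: Balaban1985Variational, (27) p.282, (36) pp.283-284] -/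
theorem tau_mul_re (hstar : ∀ X : 𝔸, τ (star X) = starRingEnd ℂ (τ X)) (hcyc : ∀ X Y : 𝔸, τ (X * Y) = τ (Y * X))
    {H : 𝔸} (hH : IsSelfAdjoint H) (U : 𝔸) :
    τ (H * ((2 : ℂ)⁻¹ • (U + star U))) = ((τ (H * U)).re : ℂ) := by
  have h1 : τ (H * star U) = starRingEnd ℂ (τ (H * U)) := by
    rw [← hstar, star_mul, hH.star_eq, hcyc H (star U)]
  rw [mul_smul_comm, map_smul, mul_add, map_add, h1, smul_eq_mul, Complex.re_eq_add_conj, div_eq_inv_mul]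

/-- For Hermitian `H`: `τ(H · (1/2i)(U − U*)) = Im τ(HU)` (the passage «tr(DA)(p) Im U₀(∂p) = Im tr(DA)(p)U₀(∂p)» of
(27)). [cite: Balaban1985Variational, (27) p.282, (36) pp.283-284] -/
theorem tau_mul_im (hstar : ∀ X : 𝔸, τ (star X) = starRingEnd ℂ (τ X)) (hcyc : ∀ X Y : 𝔸, τ (X * Y) = τ (Y * X))
    {H : 𝔸} (hH : IsSelfAdjoint H) (U : 𝔸) :
    τ (H * ((2 * Complex.I : ℂ)⁻¹ • (U - star U))) = ((τ (H * U)).im : ℂ) := by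
  have h1 : τ (H * star U) = starRingEnd ℂ (τ (H * U)) := by
    rw [← hstar, star_mul, hH.star_eq, hcyc H (star U)]
  rw [mul_smul_comm, map_smul, mul_sub, map_sub, h1, smul_eq_mul, Complex.im_eq_sub_conj, div_eq_inv_mul]

/-- For anti-Hermitian `K` (`K* = −K`): `τ(K · ½(U + U*)) = i·Im τ(KU)`. [cite: Balaban1985Variational, (36) pp.283-284] -/
theorem tau_mul_re_of_skew (hstar : ∀ X : 𝔸, τ (star X) = starRingEnd ℂ (τ X))
    (hcyc : ∀ X Y : 𝔸, τ (X * Y) = τ (Y * X)) {K : 𝔸} (hK : star K = -K) (U : 𝔸) :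
    τ (K * ((2 : ℂ)⁻¹ • (U + star U))) = Complex.I * ((τ (K * U)).im : ℂ) := by
  have h1 : τ (K * star U) = -starRingEnd ℂ (τ (K * U)) := by
    rw [← hstar, star_mul, hK, mul_neg, map_neg, neg_neg, hcyc K (star U)]
  rw [mul_smul_comm, map_smul, mul_add, map_add, h1, smul_eq_mul, Complex.im_eq_sub_conj]
  have hI : (2 * Complex.I : ℂ) ≠ 0 := mul_ne_zero two_ne_zero Complex.I_ne_zero
  field_simp
  ring

end StarFacts

section Eq36

variable {𝔸 : Type*} [NormedRing 𝔸] [NormedAlgebra ℂ 𝔸]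

open Complex
open B11Eq34BCH (Z1 comm2 comm3pair comm3triple prod3 bch4_degree3 V3 V3_eq)

/-- `ℂ`-scalar form of the degree-3 identification: `12·grade4 3 = prod3`. [cite: Balaban1985Variational, (34) p.283] -/
theorem twelve_smul_grade4_three_complex (Y₁ Y₂ Y₃ Y₄ : 𝔸) :
    (12 : ℂ) • grade4 Y₁ Y₂ Y₃ Y₄ 3 = prod3 Y₁ Y₂ Y₃ Y₄ := by
  rw [← twelve_smul_grade4_three]
  rw [show (12 : ℂ) = ((12 : ℕ) : ℂ) by norm_num, show (12 : ℝ) = ((12 : ℕ) : ℝ) by norm_num,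
    Nat.cast_smul_eq_nsmul, Nat.cast_smul_eq_nsmul]

/-- **(26)/(35), first order**: the total-degree-1 component of `∂₀U₁((p)_z) = Πexp iηA′(b)` is `Z₁ = iηΣ_b A′(b) =
iη²(DA)(p)` ((25), (34)), so `−Re tr(grade4 1 · U₀(∂p)) = η² Im tr((DA)(p)U₀(∂p))` — the linear term
«Σ_p η^{d−2} Im tr(DA)(p)U₀(∂p)» of (26) (per plaquette, before the factor `η^{d−4}`).
[cite: Balaban1985Variational, (26) p.282, (35) p.283] -/
theorem eq26_firstOrder (τ : 𝔸 →ₗ[ℂ] ℂ) {A₁ A₂ A₃ A₄ D : 𝔸} (U0 : 𝔸) {η : ℝ}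
    (hsum : A₁ + A₂ + A₃ + A₄ = (η : ℂ) • D) :
    -(τ (grade4 ((I * η : ℂ) • A₁) ((I * η : ℂ) • A₂) ((I * η : ℂ) • A₃) ((I * η : ℂ) • A₄) 1 * U0)).re
      = η ^ 2 * (τ (D * U0)).im := by
  rw [grade4_one, Z1_smul, Z1, hsum, smul_smul, smul_mul_assoc, map_smul, smul_eq_mul]
  simp only [Complex.mul_re, Complex.mul_im, Complex.I_re, Complex.I_im, Complex.ofReal_re, Complex.ofReal_im,
    zero_mul, one_mul, mul_zero, sub_zero, zero_sub, zero_add]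
  ring

/-- **(35) ⇒ (36).**  With `Yᵢ = iηA′(bᵢ)`, Hermitian `A′(bᵢ)` and `D = (DA)(p)` (`Σ_b A′(b) = η(DA)(p)`, (25)), a
trace `tr` (cyclic, `tr(X*) = conj tr X`), `Re U₀(∂p) = ½(U₀ + U₀*)` and `η⁻²Im U₀(∂p) = η⁻²(1/2i)(U₀ − U₀*)` in the
slots of the verbatim (36) `B11Eq34BCH.V3`: the third-order term of (35), `η⁴V^{(3)}(A, ∂p) = −Re tr(grade4 3 ·
U₀(∂p))` (the total-degree-3 component of `∂₀U₁((p)_z) = Πexp iηA′(b)`, (34)), EQUALS `η⁴ × (36)`.  Proof = «then (34)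
yields»: `grade4 3 = (1/12)prod3 = (1/12)(2Z₁³ + 3(Z₁C + CZ₁) + P + 2T)` (`bch4_degree3`) at `Y = iηA′`, homogeneity
`Z₁ = iη²D`, `C(Y) = −η²C(A′)`, `P(Y) = −iη³P(A′)`, `T(Y) = −iη³T(A′)`, and the trace identities `tau_mul_re`/`_im`/
`_re_of_skew` for the Hermitian `D³, P, T` and the anti-Hermitian `DC + CD`. [cite: Balaban1985Variational, (35) p.283, (36) pp.283-284] -/
theorem eq36_of_eq35 [StarRing 𝔸] (τ : 𝔸 →ₗ[ℂ] ℂ) (hstar : ∀ X : 𝔸, τ (star X) = starRingEnd ℂ (τ X))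
    (hcyc : ∀ X Y : 𝔸, τ (X * Y) = τ (Y * X)) {A₁ A₂ A₃ A₄ D U0 : 𝔸}
    (h₁ : IsSelfAdjoint A₁) (h₂ : IsSelfAdjoint A₂) (h₃ : IsSelfAdjoint A₃) (h₄ : IsSelfAdjoint A₄)
    (hD : IsSelfAdjoint D) {η : ℝ} (hη : η ≠ 0) (hsum : A₁ + A₂ + A₃ + A₄ = (η : ℂ) • D) :
    (η : ℂ) ^ 4 * V3 τ D A₁ A₂ A₃ A₄ ((2 : ℂ)⁻¹ • (U0 + star U0))
        ((((η : ℂ) ^ 2)⁻¹ * (2 * I : ℂ)⁻¹) • (U0 - star U0)) η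
      = -(((τ (grade4 ((I * η : ℂ) • A₁) ((I * η : ℂ) • A₂) ((I * η : ℂ) • A₃) ((I * η : ℂ) • A₄) 3
          * U0)).re : ℂ)) := by
  -- abbreviations
  set c : ℂ := I * η with hc
  set C := comm2 A₁ A₂ A₃ A₄ with hC
  set P := comm3pair A₁ A₂ A₃ A₄ with hP
  set T := comm3triple A₁ A₂ A₃ A₄ with hT
  -- (34): the degree-3 component, with the homogeneity in `c`
  have hZ : Z1 (c • A₁) (c • A₂) (c • A₃) (c • A₄) = (c * η) • D := by
    rw [Z1_smul, Z1, hsum, smul_smul]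
  have hg3 : grade4 (c • A₁) (c • A₂) (c • A₃) (c • A₄) 3 =
      (12 : ℂ)⁻¹ • (2 * ((c * η) • D * ((c * η) • D) * ((c * η) • D))
        + 3 * ((c * η) • D * (c ^ 2 • C) + (c ^ 2 • C) * ((c * η) • D)) + c ^ 3 • P + 2 * (c ^ 3 • T)) := by
    have h12 := twelve_smul_grade4_three_complex (c • A₁) (c • A₂) (c • A₃) (c • A₄)
    rw [bch4_degree3, hZ, comm2_smul, comm3pair_smul, comm3triple_smul] at h12
    rw [← h12, smul_smul]; norm_num
  -- Hermitian / anti-Hermitian facts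
  have hCstar : star C = -C := star_comm2 h₁ h₂ h₃ h₄
  have hPsa : IsSelfAdjoint P := star_comm3pair h₁ h₂ h₃ h₄
  have hTsa : IsSelfAdjoint T := star_comm3triple h₁ h₂ h₃ h₄
  have hD3 : IsSelfAdjoint (D * D * D) := by
    rw [IsSelfAdjoint, star_mul, star_mul, hD.star_eq, mul_assoc]
  have hK : star (D * C + C * D) = -(D * C + C * D) := by
    rw [star_add, star_mul, star_mul, hCstar, hD.star_eq]; noncomm_ring
  -- the four traces against `Re U₀`, `Im U₀`
  have tK := tau_mul_re_of_skew hstar hcyc hK U0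
  have tP := tau_mul_im hstar hcyc hPsa U0
  have tT := tau_mul_im hstar hcyc hTsa U0
  have tD := tau_mul_im hstar hcyc hD3 U0
  -- left side: (36) verbatim
  rw [V3_eq]
  rw [← hC, ← hP, ← hT]
  have eP : τ (P * ((((η : ℂ) ^ 2)⁻¹ * (2 * I : ℂ)⁻¹) • (U0 - star U0)))
      = ((η : ℂ) ^ 2)⁻¹ * ((τ (P * U0)).im : ℂ) := by
    rw [← smul_smul, mul_smul_comm, map_smul, tP, smul_eq_mul]
  have eT : τ (T * ((((η : ℂ) ^ 2)⁻¹ * (2 * I : ℂ)⁻¹) • (U0 - star U0)))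
      = ((η : ℂ) ^ 2)⁻¹ * ((τ (T * U0)).im : ℂ) := by
    rw [← smul_smul, mul_smul_comm, map_smul, tT, smul_eq_mul]
  have eD : τ (D * D * D * ((((η : ℂ) ^ 2)⁻¹ * (2 * I : ℂ)⁻¹) • (U0 - star U0)))
      = ((η : ℂ) ^ 2)⁻¹ * ((τ (D * D * D * U0)).im : ℂ) := by
    rw [← smul_smul, mul_smul_comm, map_smul, tD, smul_eq_mul]
  rw [tK, eP, eT, eD]
  -- right side: (34)/(35)
  rw [hg3, smul_mul_assoc, map_smul, smul_eq_mul]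
  have e2 : ∀ X : 𝔸, (2 : 𝔸) * X = (2 : ℂ) • X := fun X => by rw [two_mul, two_smul]
  have e3 : ∀ X : 𝔸, (3 : 𝔸) * X = (3 : ℂ) • X := fun X => by
    rw [show (3 : 𝔸) = ((3 : ℕ) : 𝔸) by norm_num, show (3 : ℂ) = ((3 : ℕ) : ℂ) by norm_num,
      Nat.cast_smul_eq_nsmul, nsmul_eq_mul]
  simp only [add_mul, map_add, smul_mul_assoc, mul_smul_comm, smul_smul, map_smul, smul_eq_mul, mul_assoc, e2, e3]
  rw [hc]
  have h12 : (12 : ℂ)⁻¹ = (((12 : ℝ)⁻¹ : ℝ) : ℂ) := by push_cast; ring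
  have h4 : (4 : ℂ)⁻¹ = (((4 : ℝ)⁻¹ : ℝ) : ℂ) := by push_cast; ring
  have h6 : (6 : ℂ)⁻¹ = (((6 : ℝ)⁻¹ : ℝ) : ℂ) := by push_cast; ring
  have hη2 : ((η : ℂ) ^ 2)⁻¹ = (((η ^ 2)⁻¹ : ℝ) : ℂ) := by push_cast; ring
  rw [h12, h4, h6, hη2]
  generalize τ (D * (C * U0)) = z₁
  generalize τ (C * (D * U0)) = z₂
  generalize τ (P * U0) = zP
  generalize τ (T * U0) = zT
  generalize τ (D * (D * (D * U0))) = zD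
  apply Complex.ext
  · simp only [Complex.mul_re, Complex.mul_im, Complex.add_re, Complex.add_im, Complex.sub_re, Complex.sub_im,
      Complex.neg_re, Complex.ofReal_re, Complex.ofReal_im, Complex.I_re, Complex.I_im,
      Complex.re_ofNat, Complex.im_ofNat, pow_succ, pow_zero, one_mul, mul_zero, zero_mul, sub_zero,
      zero_sub, add_zero, zero_add]
    field_simp
    ring
  · simp only [Complex.mul_re, Complex.mul_im, Complex.add_re, Complex.add_im, Complex.sub_re, Complex.sub_im,
      Complex.neg_im, Complex.ofReal_re, Complex.ofReal_im, Complex.I_re, Complex.I_im,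
      Complex.re_ofNat, Complex.im_ofNat, pow_succ, pow_zero, one_mul, mul_zero, zero_mul, sub_zero,
      zero_sub, add_zero, zero_add]
    field_simp
    ring

end Eq36

end Literature.MathematicalPhysics.QuantumFieldTheory.Balaban1983to89.B11Eq31V4Bound
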